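import Summits.MatrixMultiplication.MatrixMultiplication.Theorems.NilpotentLieHostsUnitriangularCostShapeModelSupports

/-!
# `UnitriangularCostShape` — Product model, part 5: level data

Crux `stmt-MatrixMultiplication-7724` (`NilpotentLieHosts.UnitriangularCostShape`), line `registered`
(`Cruxes/UnitriangularCostShape/Lines/birth.lean`), stub `stub_productModel` (the Weyl-type product model of
`U(u_d)/I^(s+1)` over the truncated Casimir algebra, `b = k = ⌊d/2⌋`).  Helper vocabulary and lemmas, namespace
`…Theorems.UnitriangularCostShape.ProductModel`.

For a level (column) `j`: `lo j`, the corner variable `zv j`, row-degree `rhoL`, test exponent `epsL`, output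
exponent `gamL`, shell and inner parts `shellL`, `innerL` of an `x`-exponent, and `β = shell + inner`.
-/

set_option linter.dupNamespace false

noncomputable section

namespace Summit.MatrixMultiplication.MatrixMultiplication.Theorems.UnitriangularCostShape.ProductModel

open MvPolynomial
open scoped BigOperators Pointwise

variable {d : ℕ}

/-- Lower row index of the block of column `j`: `d - 1 - j`. -/
def lo (j : Fin d) : Fin d := ⟨d - 1 - j, by omega⟩

/-- Value of `lo j`. -/
@[simp] theorem lo_val (j : Fin d) : ((lo j : Fin d) : ℕ) = d - 1 - j := rfl

/-- The corner (central) variable `z_j = (d-1-j, j)` of column `j` (a level when `d ≤ 2j`). -/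
def zv (j : Fin d) (hj : d ≤ 2 * (j : ℕ)) : Var d :=
  ⟨(lo j, j), by
    refine ⟨?_, ?_⟩
    · show (lo j) < j
      rw [Fin.lt_def, lo_val]; omega
    · show d ≤ ((lo j : Fin d) : ℕ) + j + 1
      rw [lo_val]; omega⟩

/-- Row of the corner variable. -/
@[simp] theorem zv_row (j : Fin d) (hj : d ≤ 2 * (j : ℕ)) : (zv j hj).row = lo j := rfl
/-- Column of the corner variable. -/
@[simp] theorem zv_col (j : Fin d) (hj : d ≤ 2 * (j : ℕ)) : (zv j hj).col = j := rfl

/-- Variables of column `j` have row `≥ lo j`. -/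
theorem lo_le_row_of_col {j : Fin d} {u : Var d} (hu : u.col = j) : lo j ≤ u.row := by
  rw [Fin.le_def, lo_val]
  have := u.le_row_add_col
  rw [hu] at this
  omega

/-- The only variable of column `j` in row `lo j` is the corner. -/
theorem eq_zv_of_row_eq_lo {j : Fin d} (hj : d ≤ 2 * (j : ℕ)) {u : Var d} (hu : u.col = j)
    (hr : u.row = lo j) : u = zv j hj := by
  apply Subtype.ext
  exact Prod.ext hr hu

/-- `x`-weight of a position: `j - i`. -/
def xw (p : Fin d × Fin d) : ℕ := (p.2 : ℕ) - p.1

/-- Row-degree at level `j`: total exponent on the row-type positions `(lo j, i)`, `lo j < i < j`. -/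
def rhoL (j : Fin d) (β : Fin d × Fin d →₀ ℕ) : ℕ :=
  ∑ u : Var d, if u.col = j ∧ lo j < u.row then β (lo j, u.row) else 0

/-- Row-degree is additive. -/
theorem rhoL_add (j : Fin d) (β β' : Fin d × Fin d →₀ ℕ) : rhoL j (β + β') = rhoL j β + rhoL j β' := by
  unfold rhoL
  rw [← Finset.sum_add_distrib]
  refine Finset.sum_congr rfl fun u _ => ?_
  split_ifs <;> simp

/-- Row-degree of `0`. -/
@[simp] theorem rhoL_zero (j : Fin d) : rhoL j 0 = 0 := by
  unfold rhoL; simp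

/-- Test exponent at level `j`: `v_{(i,j)} ↦ β (lo j, i)` for the `q`-variables of column `j`. -/
def epsL (j : Fin d) (β : Fin d × Fin d →₀ ℕ) : Var d →₀ ℕ :=
  Finsupp.equivFunOnFinite.symm fun u => if u.col = j ∧ lo j < u.row then β (lo j, u.row) else 0

/-- Values of the test exponent. -/
@[simp] theorem epsL_apply (j : Fin d) (β : Fin d × Fin d →₀ ℕ) (u : Var d) :
    epsL j β u = if u.col = j ∧ lo j < u.row then β (lo j, u.row) else 0 := by
  simp [epsL]

/-- Output exponent at level `j`: `v_{(i,j)} ↦ β (i, j)`, plus `ρ_j(β)` on the corner. -/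
def gamL (j : Fin d) (β : Fin d × Fin d →₀ ℕ) : Var d →₀ ℕ :=
  Finsupp.equivFunOnFinite.symm fun u =>
    if u.col = j then β (u.row, j) + (if u.row = lo j then rhoL j β else 0) else 0

/-- Values of the output exponent. -/
@[simp] theorem gamL_apply (j : Fin d) (β : Fin d × Fin d →₀ ℕ) (u : Var d) :
    gamL j β u = if u.col = j then β (u.row, j) + (if u.row = lo j then rhoL j β else 0) else 0 := by
  simp [gamL]

/-- The shell part of `β` at level `j` (row `lo j` and column `j`), as an explicit sum. -/
def shellL (j : Fin d) (β : Fin d × Fin d →₀ ℕ) : Fin d × Fin d →₀ ℕ :=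
  (∑ u : Var d, if u.col = j ∧ lo j < u.row then β (lo j, u.row) • Finsupp.single (lo j, u.row) 1 else 0) +
  ∑ u : Var d, if u.col = j then β (u.row, j) • Finsupp.single (u.row, j) 1 else 0

/-- The inner part of `β` at level `j`. -/
def innerL (j : Fin d) (β : Fin d × Fin d →₀ ℕ) : Fin d × Fin d →₀ ℕ :=
  β.filter fun p => lo j < p.1 ∧ p.2 < j

/-- Evaluating a sum of scaled unit vectors indexed by variables of column `j`. -/
theorem sum_var_single_apply (j : Fin d) (f : Fin d → ℕ) (g : Fin d → Fin d × Fin d) (P : Var d → Prop)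
    [DecidablePred P] (p : Fin d × Fin d) :
    (∑ u : Var d, if u.col = j ∧ P u then f u.row • Finsupp.single (g u.row) 1 else 0) p =
      ∑ u : Var d, if u.col = j ∧ P u ∧ g u.row = p then f u.row else 0 := by
  rw [Finsupp.finsetSum_apply]
  refine Finset.sum_congr rfl fun u _ => ?_
  by_cases h : u.col = j ∧ P u
  · rw [if_pos h]
    by_cases h' : g u.row = p
    · simp [h, h']
    · simp [h, h']
  · rw [if_neg h, if_neg (fun h' => h ⟨h'.1, h'.2.1⟩)]; rfl

/-- Values of the shell part. -/
theorem shellL_apply (j : Fin d) (β : Fin d × Fin d →₀ ℕ) (p : Fin d × Fin d) :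
    shellL j β p = (if p.1 = lo j ∧ lo j < p.2 ∧ p.2 < j then β p else 0) +
      (if p.2 = j ∧ lo j ≤ p.1 ∧ p.1 < j then β p else 0) := by
  classical
  unfold shellL
  rw [Finsupp.add_apply]
  congr 1
  · rw [sum_var_single_apply j (fun i => β (lo j, i)) (fun i => (lo j, i)) (fun u => lo j < u.row) p]
    by_cases hp : p.1 = lo j ∧ lo j < p.2 ∧ p.2 < j
    · rw [if_pos hp]
      have hv : p.2 < j ∧ d ≤ (p.2 : ℕ) + j + 1 := by
        refine ⟨hp.2.2, ?_⟩
        have := hp.2.1; rw [Fin.lt_def, lo_val] at this; omega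
      have e : ((lo j, p.2) : Fin d × Fin d) = p := Prod.ext hp.1.symm rfl
      rw [Finset.sum_eq_single (⟨(p.2, j), hv⟩ : Var d)]
      · have hc : Var.col (⟨(p.2, j), hv⟩ : Var d) = j ∧ lo j < Var.row (⟨(p.2, j), hv⟩ : Var d) ∧
            ((lo j, Var.row (⟨(p.2, j), hv⟩ : Var d)) : Fin d × Fin d) = p := ⟨rfl, hp.2.1, e⟩
        rw [if_pos hc]
        show β (lo j, p.2) = β p
        rw [e]
      · intro u _ hu
        rw [if_neg]
        rintro ⟨h1, _, h3⟩
        apply hu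
        apply Subtype.ext
        show u.1 = (p.2, j)
        have h4 : Var.row u = p.2 := by rw [← h3]
        exact Prod.ext h4 h1
      · intro h; exact absurd (Finset.mem_univ _) h
    · rw [if_neg hp]
      refine Finset.sum_eq_zero fun u _ => ?_
      rw [if_neg]
      rintro ⟨h1, h2, h3⟩
      apply hp
      rw [← h3]
      exact ⟨rfl, h2, lt_of_lt_of_eq u.row_lt_col h1⟩
  · have := sum_var_single_apply j (fun i => β (i, j)) (fun i => (i, j)) (fun _ => True) p
    simp only [and_true, true_and] at this
    rw [this]
    by_cases hp : p.2 = j ∧ lo j ≤ p.1 ∧ p.1 < j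
    · rw [if_pos hp]
      have hv : p.1 < p.2 ∧ d ≤ (p.1 : ℕ) + p.2 + 1 := by
        rw [hp.1]
        refine ⟨hp.2.2, ?_⟩
        have := hp.2.1; rw [Fin.le_def, lo_val] at this; omega
      have e : ((p.1, j) : Fin d × Fin d) = p := Prod.ext rfl hp.1.symm
      rw [Finset.sum_eq_single (⟨p, hv⟩ : Var d)]
      · have hc : Var.col (⟨p, hv⟩ : Var d) = j ∧ ((Var.row (⟨p, hv⟩ : Var d), j) : Fin d × Fin d) = p :=
          ⟨hp.1, e⟩
        rw [if_pos hc]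
        show β (p.1, j) = β p
        rw [e]
      · intro u _ hu
        rw [if_neg]
        rintro ⟨h1, h3⟩
        apply hu
        apply Subtype.ext
        show u.1 = p
        rw [← h3]
        exact Prod.ext rfl h1
      · intro h; exact absurd (Finset.mem_univ _) h
    · rw [if_neg hp]
      refine Finset.sum_eq_zero fun u _ => ?_
      rw [if_neg]
      rintro ⟨h1, h3⟩
      apply hp
      rw [← h3]
      exact ⟨rfl, lo_le_row_of_col h1, lt_of_lt_of_eq u.row_lt_col h1⟩

/-- `β = shell + inner` for `β` supported in the upper block of column `j`. -/
theorem shellL_add_innerL (j : Fin d) (β : Fin d × Fin d →₀ ℕ)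
    (hβ : ∀ p ∈ β.support, lo j ≤ p.1 ∧ p.1 < p.2 ∧ p.2 ≤ j) :
    shellL j β + innerL j β = β := by
  classical
  ext p
  rw [Finsupp.add_apply, shellL_apply j, innerL, Finsupp.filter_apply]
  by_cases h0 : β p = 0
  · simp [h0]
  obtain ⟨h1, h2, h3⟩ := hβ p (Finsupp.mem_support_iff.mpr h0)
  by_cases hin : lo j < p.1 ∧ p.2 < j
  · rw [if_pos hin, if_neg, if_neg, zero_add, zero_add]
    · rintro ⟨h, _⟩; exact absurd hin.2 (by rw [h]; exact lt_irrefl _)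
    · rintro ⟨h, _⟩; exact absurd hin.1 (by rw [h]; exact lt_irrefl _)
  · rw [if_neg hin, add_zero]
    by_cases hp2 : p.2 < j
    · have hp1 : p.1 = lo j := by
        rcases not_and_or.mp hin with h | h
        · exact le_antisymm (not_lt.mp h) h1
        · exact absurd hp2 h
      have c1 : p.1 = lo j ∧ lo j < p.2 ∧ p.2 < j := ⟨hp1, lt_of_eq_of_lt hp1.symm h2, hp2⟩
      have c2 : ¬ (p.2 = j ∧ lo j ≤ p.1 ∧ p.1 < j) := fun hc => absurd hc.1 (ne_of_lt hp2)
      rw [if_pos c1, if_neg c2, add_zero]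
    · have hp2' : p.2 = j := le_antisymm h3 (not_lt.mp hp2)
      have c1 : ¬ (p.1 = lo j ∧ lo j < p.2 ∧ p.2 < j) := fun hc => hp2 hc.2.2
      have c2 : p.2 = j ∧ lo j ≤ p.1 ∧ p.1 < j := ⟨hp2', h1, lt_of_lt_of_eq h2 hp2'⟩
      rw [if_neg c1, if_pos c2, zero_add]

/-- The inner part is supported in the upper block of column `j - 1`. -/
theorem innerL_support (j : Fin d) (β : Fin d × Fin d →₀ ℕ)
    (hβ : ∀ p ∈ β.support, lo j ≤ p.1 ∧ p.1 < p.2 ∧ p.2 ≤ j) :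
    ∀ p ∈ (innerL j β).support, lo j < p.1 ∧ p.1 < p.2 ∧ (p.2 : ℕ) + 1 ≤ j := by
  classical
  intro p hp
  rw [innerL, Finsupp.support_filter, Finset.mem_filter] at hp
  obtain ⟨_, h2, _⟩ := hβ p hp.1
  exact ⟨hp.2.1, h2, hp.2.2⟩

/-- The inner part has row-degree `0` at level `j`. -/
theorem rhoL_innerL (j : Fin d) (β : Fin d × Fin d →₀ ℕ) : rhoL j (innerL j β) = 0 := by
  classical
  unfold rhoL
  refine Finset.sum_eq_zero fun u _ => ?_
  split_ifs with h
  · rw [innerL, Finsupp.filter_apply, if_neg]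
    rintro ⟨h', _⟩; exact lt_irrefl _ h'
  · rfl

/-- The shell monomial as an explicit product of variables. -/
theorem monomial_shellL (j : Fin d) (β : Fin d × Fin d →₀ ℕ) :
    (monomial (shellL j β) (1 : ℂ) : A d) =
      (∏ u : Var d, if u.col = j ∧ lo j < u.row then X (lo j, u.row) ^ β (lo j, u.row) else 1) *
      ∏ u : Var d, if u.col = j then X (u.row, j) ^ β (u.row, j) else 1 := by
  classical
  unfold shellL
  rw [← mul_one (1 : ℂ), ← monomial_mul, monomial_sum_index, monomial_sum_index, C_1, one_mul, one_mul]
  congr 1 <;> refine Finset.prod_congr rfl fun u _ => ?_ <;> split_ifs <;>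
    simp [X_pow_eq_monomial]

/-- Landing hook of part 5: `β = shell + inner`. -/
theorem stub_pm_shell : ∀ (d : ℕ) (j : Fin d) (β : Fin d × Fin d →₀ ℕ), (∀ p ∈ β.support, lo j ≤ p.1 ∧ p.1 < p.2 ∧ p.2 ≤ j) → shellL j β + innerL j β = β :=
  fun _ j β hβ => shellL_add_innerL j β hβ

end Summit.MatrixMultiplication.MatrixMultiplication.Theorems.UnitriangularCostShape.ProductModel
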